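import Summits.Ventures.PercRepro.S1TriangleSevenB

/-!
# PercRepro — `P(7) = 11`, PART 2: the cone of a degree-`3` point and two counting lemmas (p2, gen 17)

For a point `x` on exactly three triangles `L₁, L₂, L₃` (C1): two of them span `5` points of rank `≤ 3`, the cone
`C = L₁ ∪ L₂ ∪ L₃` has `7` points and rank exactly `4` (C2), and no triangle inside the cone avoids `x` — two of its
points on one line would make that line `4`-point, one point per line would put the third line inside the plane of
the other two. Also: the double count `2·|S| ≤ 3·|Y|` for triangles with two points in `Y`, and «two distinct
triangles share at most one point».

* `two_lines_ncard_eRk`, **`cone_ncard_eRk`**, **`no_triangle_in_cone_avoiding_apex`**;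
* `two_mul_ncard_le_three_mul_of_two_points`, `two_triangles_share_pair`.
Axioms: standard.
-/

open scoped Matroid

namespace PercRepro

namespace S1

open Set

variable {α : Type}

/-- Two distinct lines through `x` have `5` points and span a set of rank `≤ 3`. -/
theorem two_lines_ncard_eRk (M : Matroid α) [M.Finite] (hC1 : ∀ L ⊆ M.E, M.eRk L = 2 → L.ncard ≤ 3)
    {x : α} (hx : M.IsNonloop x) {Li Lj : Set α} (hi : Li ∈ ThmN.trianglesThrough M x)
    (hj : Lj ∈ ThmN.trianglesThrough M x) (hij : Li ≠ Lj) : (Li ∪ Lj).ncard = 5 ∧ M.eRk (Li ∪ Lj) ≤ 3 := by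
  classical
  have hs2 : ∀ C ∈ ({Li, Lj} : Finset (Set α)), C ∈ ThmN.trianglesThrough M x := by
    intro C hC
    simp only [Finset.mem_insert, Finset.mem_singleton] at hC
    rcases hC with rfl | rfl <;> assumption
  have hU2 : ({x} ∪ ⋃ C ∈ ({Li, Lj} : Finset (Set α)), C) = Li ∪ Lj := by
    ext z
    simp only [Set.mem_union, Set.mem_singleton_iff, Set.mem_iUnion, Finset.mem_insert,
      Finset.mem_singleton, exists_prop, exists_eq_or_imp, exists_eq_left]
    constructor
    · rintro (rfl | h | h)
      · exact Or.inl hi.2.2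
      · exact Or.inl h
      · exact Or.inr h
    · rintro (h | h)
      · exact Or.inr (Or.inl h)
      · exact Or.inr (Or.inr h)
  obtain ⟨hr2, hn2⟩ := ThmN.eRk_le_and_ncard_eq_of_triangles M hC1 hx _ hs2
  rw [hU2, Finset.card_pair hij] at hr2 hn2
  have : ((1 + 2 : ℕ) : ℕ∞) = 3 := by norm_num
  rw [this] at hr2
  exact ⟨by rw [hn2], hr2⟩

/-- **The cone of a degree-`3` point**: for `x` on the three distinct triangles `L₁, L₂, L₃`, the set
`C = L₁ ∪ L₂ ∪ L₃` has `7` points and rank `≤ 4`; under (C2) its rank is exactly `4`. -/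
theorem cone_ncard_eRk (M : Matroid α) [M.Finite] (hC1 : ∀ L ⊆ M.E, M.eRk L = 2 → L.ncard ≤ 3)
    (hC2 : ∀ P ⊆ M.E, M.eRk P ≤ 3 → P.ncard ≤ 6) {x : α} (hx : M.IsNonloop x)
    {L₁ L₂ L₃ : Set α} (h1 : L₁ ∈ ThmN.trianglesThrough M x) (h2 : L₂ ∈ ThmN.trianglesThrough M x)
    (h3 : L₃ ∈ ThmN.trianglesThrough M x) (h12 : L₁ ≠ L₂) (h13 : L₁ ≠ L₃) (h23 : L₂ ≠ L₃) :
    (L₁ ∪ L₂ ∪ L₃).ncard = 7 ∧ M.eRk (L₁ ∪ L₂ ∪ L₃) = 4 := by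
  classical
  have hx1 : x ∈ L₁ := h1.2.2
  have hs3 : ∀ C ∈ ({L₁, L₂, L₃} : Finset (Set α)), C ∈ ThmN.trianglesThrough M x := by
    intro C hC
    simp only [Finset.mem_insert, Finset.mem_singleton] at hC
    rcases hC with rfl | rfl | rfl <;> assumption
  have hcard3 : ({L₁, L₂, L₃} : Finset (Set α)).card = 3 := by
    rw [Finset.card_insert_of_notMem, Finset.card_pair h23]
    simp only [Finset.mem_insert, Finset.mem_singleton, not_or]
    exact ⟨h12, h13⟩
  have hU : ({x} ∪ ⋃ C ∈ ({L₁, L₂, L₃} : Finset (Set α)), C) = L₁ ∪ L₂ ∪ L₃ := by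
    ext z
    simp only [Set.mem_union, Set.mem_singleton_iff, Set.mem_iUnion, Finset.mem_insert,
      Finset.mem_singleton, exists_prop, exists_eq_or_imp, exists_eq_left]
    constructor
    · rintro (rfl | h | h | h)
      · exact Or.inl (Or.inl hx1)
      · exact Or.inl (Or.inl h)
      · exact Or.inl (Or.inr h)
      · exact Or.inr h
    · rintro ((h | h) | h)
      · exact Or.inr (Or.inl h)
      · exact Or.inr (Or.inr (Or.inl h))
      · exact Or.inr (Or.inr (Or.inr h))
  obtain ⟨hr, hn⟩ := ThmN.eRk_le_and_ncard_eq_of_triangles M hC1 hx _ hs3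
  rw [hU, hcard3] at hr hn
  have hn7 : (L₁ ∪ L₂ ∪ L₃).ncard = 7 := by rw [hn]
  have hr4 : M.eRk (L₁ ∪ L₂ ∪ L₃) ≤ 4 := by
    have : ((1 + 3 : ℕ) : ℕ∞) = 4 := by norm_num
    rw [this] at hr; exact hr
  refine ⟨hn7, ?_⟩
  have hCE : L₁ ∪ L₂ ∪ L₃ ⊆ M.E :=
    Set.union_subset (Set.union_subset h1.1.subset_ground h2.1.subset_ground) h3.1.subset_ground
  by_contra hne
  have hlt : M.eRk (L₁ ∪ L₂ ∪ L₃) ≤ 3 := by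
    rcases lt_or_eq_of_le hr4 with h | h
    · exact Order.le_of_lt_succ h
    · exact absurd h hne
  have := hC2 _ hCE hlt
  omega

/-- **No triangle inside the cone of a degree-`3` point avoids the apex** (under (C1), (C2)). -/
theorem no_triangle_in_cone_avoiding_apex (M : Matroid α) [M.Finite]
    (hC1 : ∀ L ⊆ M.E, M.eRk L = 2 → L.ncard ≤ 3) (hC2 : ∀ P ⊆ M.E, M.eRk P ≤ 3 → P.ncard ≤ 6)
    {x : α} (hx : M.IsNonloop x) (hx3 : (ThmN.trianglesThrough M x).ncard = 3)
    {L₁ L₂ L₃ : Set α} (h1 : L₁ ∈ ThmN.trianglesThrough M x) (h2 : L₂ ∈ ThmN.trianglesThrough M x)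
    (h3 : L₃ ∈ ThmN.trianglesThrough M x) (h12 : L₁ ≠ L₂) (h13 : L₁ ≠ L₃) (h23 : L₂ ≠ L₃)
    {T : Set α} (hT : T ∈ ThmN.triangles M) (hTC : T ⊆ L₁ ∪ L₂ ∪ L₃) (hxT : x ∉ T) : False := by
  classical
  obtain ⟨hn7, hr4⟩ := cone_ncard_eRk M hC1 hC2 hx h1 h2 h3 h12 h13 h23
  have hTE : T ⊆ M.E := hT.1.subset_ground
  have hTfin : T.Finite := M.ground_finite.subset hTE
  -- the three triangles through `x` are exactly `L₁, L₂, L₃`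
  have hthree : ∀ L ∈ ThmN.trianglesThrough M x, L = L₁ ∨ L = L₂ ∨ L = L₃ := by
    intro L hL
    by_contra hno
    push Not at hno
    have hsub4 : ({L₁, L₂, L₃, L} : Set (Set α)) ⊆ ThmN.trianglesThrough M x := by
      intro Z hZ
      simp only [Set.mem_insert_iff, Set.mem_singleton_iff] at hZ
      rcases hZ with rfl | rfl | rfl | rfl <;> assumption
    have hfin : (ThmN.trianglesThrough M x).Finite :=
      M.ground_finite.finite_subsets.subset (fun C hC => hC.1.subset_ground)
    have h4 : ({L₁, L₂, L₃, L} : Set (Set α)).ncard = 4 := by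
      rw [Set.ncard_insert_of_notMem, Set.ncard_insert_of_notMem, Set.ncard_pair]
      · exact fun h => hno.2.2 h.symm
      · simp only [Set.mem_insert_iff, Set.mem_singleton_iff, not_or]
        exact ⟨h23, fun h => hno.2.1 h.symm⟩
      · simp only [Set.mem_insert_iff, Set.mem_singleton_iff, not_or]
        exact ⟨h12, h13, fun h => hno.1 h.symm⟩
    have hle := Set.ncard_le_ncard hsub4 hfin
    omega
  -- two points of `T` on one line `L` through `x` put `T ∪ L` (`≥ 4` points) on a rank-`2` set
  have hsame : ∀ L ∈ ThmN.trianglesThrough M x, ∀ a ∈ T, ∀ b ∈ T, a ≠ b → a ∈ L → b ∈ L → False := by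
    intro L hL a ha b hb hab haL hbL
    have hLT : L ∈ ThmN.triangles M := ⟨hL.1, hL.2.1⟩
    have hT' := triangle_subset_closure_pair M hT ha hb hab
    have hL' := triangle_subset_closure_pair M hLT haL hbL hab
    have hW : T ∪ L ⊆ M.closure {a, b} := Set.union_subset hT' hL'
    have hWE : T ∪ L ⊆ M.E := Set.union_subset hTE hL.1.subset_ground
    have hrW : M.eRk (T ∪ L) = 2 := by
      refine le_antisymm ?_ ?_
      · calc M.eRk (T ∪ L) ≤ M.eRk (M.closure {a, b}) := M.eRk_mono hW
          _ = M.eRk {a, b} := M.eRk_closure_eq _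
          _ ≤ ({a, b} : Set α).encard := M.eRk_le_encard _
          _ = 2 := by rw [Set.encard_pair hab]
      · rw [← ThmN.eRk_eq_two_of_mem_trianglesThrough M hL]
        exact M.eRk_mono Set.subset_union_right
    have hcard := hC1 _ hWE hrW
    have hLfin : L.Finite := M.ground_finite.subset hL.1.subset_ground
    have hne : T ≠ T ∪ L := by
      intro h
      have : x ∈ T := by rw [h]; exact Or.inr hL.2.2
      exact hxT this
    have hlt := Set.ncard_lt_ncard (Set.subset_union_left.ssubset_of_ne hne) (hTfin.union hLfin)
    rw [hT.2] at hlt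
    omega
  -- points of `T` on three different lines `Li, Lj, Lk`: the third point lies in `cl(Li ∪ Lj)`, of rank `≤ 3`,
  -- and then so does the whole cone
  have key : ∀ Li ∈ ThmN.trianglesThrough M x, ∀ Lj ∈ ThmN.trianglesThrough M x,
      ∀ Lk ∈ ThmN.trianglesThrough M x, Li ≠ Lj → Li ≠ Lk → Lj ≠ Lk →
      ∀ p ∈ T, ∀ q ∈ T, ∀ r ∈ T, p ≠ q → p ≠ r → q ≠ r → p ∈ Li → q ∈ Lj → r ∈ Lk → False := by
    intro Li hLi Lj hLj Lk hLk hij hik hjk p hp q hq r hr hpq hpr hqr hpi hqj hrk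
    have hrij := (two_lines_ncard_eRk M hC1 hx hLi hLj hij).2
    have hT' := triangle_subset_closure_pair M hT hp hq hpq
    have hLijE : Li ∪ Lj ⊆ M.E := Set.union_subset hLi.1.subset_ground hLj.1.subset_ground
    have hLij : ({p, q} : Set α) ⊆ Li ∪ Lj :=
      Set.insert_subset (Or.inl hpi) (Set.singleton_subset_iff.2 (Or.inr hqj))
    have hrP : r ∈ M.closure (Li ∪ Lj) := (M.closure_subset_closure hLij) (hT' hr)
    have hxP : x ∈ M.closure (Li ∪ Lj) := M.mem_closure_of_mem (Or.inl hLi.2.2) hLijE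
    have hrx : r ≠ x := fun h => hxT (h ▸ hr)
    have hLk' := triangle_subset_closure_pair M ⟨hLk.1, hLk.2.1⟩ hLk.2.2 hrk hrx.symm
    have hxr : ({x, r} : Set α) ⊆ M.closure (Li ∪ Lj) :=
      Set.insert_subset hxP (Set.singleton_subset_iff.2 hrP)
    have hLkP : Lk ⊆ M.closure (Li ∪ Lj) :=
      hLk'.trans ((M.closure_subset_closure hxr).trans (by rw [M.closure_closure]))
    have hLiP : Li ⊆ M.closure (Li ∪ Lj) := fun z hz => M.subset_closure _ hLijE (Or.inl hz)
    have hLjP : Lj ⊆ M.closure (Li ∪ Lj) := fun z hz => M.subset_closure _ hLijE (Or.inr hz)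
    have hcone : L₁ ∪ L₂ ∪ L₃ ⊆ M.closure (Li ∪ Lj) := by
      have hsub : L₁ ∪ L₂ ∪ L₃ ⊆ Li ∪ Lj ∪ Lk := by
        rcases hthree Li hLi with rfl | rfl | rfl <;> rcases hthree Lj hLj with rfl | rfl | rfl <;>
          rcases hthree Lk hLk with rfl | rfl | rfl <;>
          first
          | exact absurd rfl hij
          | exact absurd rfl hik
          | exact absurd rfl hjk
          | (intro z hz; simp only [Set.mem_union] at hz ⊢; tauto)
      exact hsub.trans (Set.union_subset (Set.union_subset hLiP hLjP) hLkP)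
    have : M.eRk (L₁ ∪ L₂ ∪ L₃) ≤ 3 := by
      calc M.eRk (L₁ ∪ L₂ ∪ L₃) ≤ M.eRk (M.closure (Li ∪ Lj)) := M.eRk_mono hcone
        _ = M.eRk (Li ∪ Lj) := M.eRk_closure_eq _
        _ ≤ 3 := hrij
    rw [hr4] at this
    exact absurd this (by norm_num)
  obtain ⟨a, b, c, hab, hac, hbc, hTabc⟩ := Set.ncard_eq_three.1 hT.2
  have ha : a ∈ T := by rw [hTabc]; simp
  have hb : b ∈ T := by rw [hTabc]; simp
  have hc : c ∈ T := by rw [hTabc]; simp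
  have hone : ∀ z ∈ T, z ∈ L₁ ∨ z ∈ L₂ ∨ z ∈ L₃ := by
    intro z hz
    rcases hTC hz with (h | h) | h
    · exact Or.inl h
    · exact Or.inr (Or.inl h)
    · exact Or.inr (Or.inr h)
  rcases hone a ha with ha1 | ha2 | ha3 <;> rcases hone b hb with hb1 | hb2 | hb3 <;>
    rcases hone c hc with hc1 | hc2 | hc3
  · exact hsame L₁ h1 a ha b hb hab ha1 hb1
  · exact hsame L₁ h1 a ha b hb hab ha1 hb1
  · exact hsame L₁ h1 a ha b hb hab ha1 hb1
  · exact hsame L₁ h1 a ha c hc hac ha1 hc1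
  · exact hsame L₂ h2 b hb c hc hbc hb2 hc2
  · exact key L₁ h1 L₂ h2 L₃ h3 h12 h13 h23 a ha b hb c hc hab hac hbc ha1 hb2 hc3
  · exact hsame L₁ h1 a ha c hc hac ha1 hc1
  · exact key L₁ h1 L₃ h3 L₂ h2 h13 h12 (Ne.symm h23) a ha b hb c hc hab hac hbc ha1 hb3 hc2
  · exact hsame L₃ h3 b hb c hc hbc hb3 hc3
  · exact hsame L₁ h1 b hb c hc hbc hb1 hc1
  · exact hsame L₂ h2 a ha c hc hac ha2 hc2
  · exact key L₂ h2 L₁ h1 L₃ h3 (Ne.symm h12) h23 h13 a ha b hb c hc hab hac hbc ha2 hb1 hc3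
  · exact hsame L₂ h2 a ha b hb hab ha2 hb2
  · exact hsame L₂ h2 a ha b hb hab ha2 hb2
  · exact hsame L₂ h2 a ha b hb hab ha2 hb2
  · exact key L₂ h2 L₃ h3 L₁ h1 h23 (Ne.symm h12) (Ne.symm h13) a ha b hb c hc hab hac hbc ha2 hb3 hc1
  · exact hsame L₂ h2 a ha c hc hac ha2 hc2
  · exact hsame L₃ h3 b hb c hc hbc hb3 hc3
  · exact hsame L₁ h1 b hb c hc hbc hb1 hc1
  · exact key L₃ h3 L₁ h1 L₂ h2 (Ne.symm h13) (Ne.symm h23) h12 a ha b hb c hc hab hac hbc ha3 hb1 hc2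
  · exact hsame L₃ h3 a ha c hc hac ha3 hc3
  · exact key L₃ h3 L₂ h2 L₁ h1 (Ne.symm h23) (Ne.symm h13) (Ne.symm h12) a ha b hb c hc hab hac hbc ha3 hb2 hc1
  · exact hsame L₂ h2 b hb c hc hbc hb2 hc2
  · exact hsame L₃ h3 a ha c hc hac ha3 hc3
  · exact hsame L₃ h3 a ha b hb hab ha3 hb3
  · exact hsame L₃ h3 a ha b hb hab ha3 hb3
  · exact hsame L₃ h3 a ha b hb hab ha3 hb3

/-- **Double count over a set of points `Y`**: if every triangle of a family `S` has `≥ 2` points in `Y` and every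
point of `Y` lies on `≤ 3` triangles, then `2·|S| ≤ 3·|Y|`. -/
theorem two_mul_ncard_le_three_mul_of_two_points (M : Matroid α) [M.Finite] {S : Set (Set α)}
    (hS : S ⊆ ThmN.triangles M) {Y : Set α} (hY : Y ⊆ M.E)
    (hrow : ∀ T ∈ S, 2 ≤ (T ∩ Y).ncard) (hcol : ∀ y ∈ Y, (ThmN.trianglesThrough M y).ncard ≤ 3) :
    2 * S.ncard ≤ 3 * Y.ncard := by
  classical
  have hTfin : (ThmN.triangles M).Finite :=
    M.ground_finite.finite_subsets.subset (fun C hC => hC.1.subset_ground)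
  have hSfin : S.Finite := hTfin.subset hS
  have hYfin : Y.Finite := M.ground_finite.subset hY
  set Sf : Finset (Set α) := hSfin.toFinset with hSf
  set Yf : Finset α := hYfin.toFinset with hYf
  have hmemS : ∀ C, C ∈ Sf ↔ C ∈ S := fun C => Set.Finite.mem_toFinset hSfin
  have hmemY : ∀ y, y ∈ Yf ↔ y ∈ Y := fun y => Set.Finite.mem_toFinset hYfin
  have hswap : ∑ y ∈ Yf, ∑ C ∈ Sf, (if y ∈ C then 1 else 0) =
      ∑ C ∈ Sf, ∑ y ∈ Yf, (if y ∈ C then 1 else 0) := Finset.sum_comm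
  have hrow' : ∀ C ∈ Sf, 2 ≤ ∑ y ∈ Yf, (if y ∈ C then 1 else 0) := by
    intro C hC
    rw [Finset.sum_boole, Nat.cast_id]
    have hCS : C ∈ S := (hmemS C).1 hC
    have hCfin : (C ∩ Y).Finite := hYfin.subset Set.inter_subset_right
    have hfilter : (Yf.filter (fun y => y ∈ C)) = hCfin.toFinset := by
      ext y
      simp only [Finset.mem_filter, Set.Finite.mem_toFinset, Set.mem_inter_iff, hmemY]
      tauto
    rw [hfilter, ← Set.ncard_eq_toFinset_card _ hCfin]
    exact hrow C hCS
  have hcol' : ∀ y ∈ Yf, ∑ C ∈ Sf, (if y ∈ C then 1 else 0) ≤ 3 := by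
    intro y hy
    rw [Finset.sum_boole, Nat.cast_id]
    have hsub : ((Sf.filter (fun C => y ∈ C)) : Set (Set α)) ⊆ ThmN.trianglesThrough M y := by
      intro C hC
      simp only [Finset.coe_filter, Set.mem_setOf_eq, hmemS] at hC
      exact ⟨(hS hC.1).1, (hS hC.1).2, hC.2⟩
    have hfin : (ThmN.trianglesThrough M y).Finite :=
      M.ground_finite.finite_subsets.subset (fun C hC => hC.1.subset_ground)
    have := Set.ncard_le_ncard hsub hfin
    rw [Set.ncard_coe_finset] at this
    exact this.trans (hcol y ((hmemY y).1 hy))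
  have h1 : 2 * Sf.card ≤ ∑ C ∈ Sf, ∑ y ∈ Yf, (if y ∈ C then 1 else 0) := by
    calc 2 * Sf.card = ∑ _C ∈ Sf, 2 := by rw [Finset.sum_const, smul_eq_mul, mul_comm]
      _ ≤ _ := Finset.sum_le_sum hrow'
  have h2 : ∑ y ∈ Yf, ∑ C ∈ Sf, (if y ∈ C then 1 else 0) ≤ 3 * Yf.card := by
    calc ∑ y ∈ Yf, ∑ C ∈ Sf, (if y ∈ C then 1 else 0) ≤ ∑ _y ∈ Yf, 3 := Finset.sum_le_sum hcol'
      _ = 3 * Yf.card := by rw [Finset.sum_const, smul_eq_mul, mul_comm]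
  rw [← hswap] at h1
  have hS' : Sf.card = S.ncard := by rw [hSf, ← Set.ncard_eq_toFinset_card _ hSfin]
  have hY' : Yf.card = Y.ncard := by rw [hYf, ← Set.ncard_eq_toFinset_card _ hYfin]
  rw [hS'] at h1
  rw [hY'] at h2
  omega

/-- **Two distinct triangles share at most one point** (C1): two common points put their union — four points —
on a rank-`2` set. -/
theorem two_triangles_share_pair (M : Matroid α) [M.Finite] (hC1 : ∀ L ⊆ M.E, M.eRk L = 2 → L.ncard ≤ 3)
    {T L : Set α} (hT : T ∈ ThmN.triangles M) (hL : L ∈ ThmN.triangles M) (hTL : T ≠ L)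
    {a b : α} (haT : a ∈ T) (haL : a ∈ L) (hbT : b ∈ T) (hbL : b ∈ L) (hab : a ≠ b) : False := by
  classical
  have hTE : T ⊆ M.E := hT.1.subset_ground
  have hLE : L ⊆ M.E := hL.1.subset_ground
  have hTfin : T.Finite := M.ground_finite.subset hTE
  have hLfin : L.Finite := M.ground_finite.subset hLE
  have hT' := triangle_subset_closure_pair M hT haT hbT hab
  have hL' := triangle_subset_closure_pair M hL haL hbL hab
  have hW : T ∪ L ⊆ M.closure {a, b} := Set.union_subset hT' hL'
  have hWE : T ∪ L ⊆ M.E := Set.union_subset hTE hLE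
  have hrW : M.eRk (T ∪ L) = 2 := by
    refine le_antisymm ?_ ?_
    · calc M.eRk (T ∪ L) ≤ M.eRk (M.closure {a, b}) := M.eRk_mono hW
        _ = M.eRk {a, b} := M.eRk_closure_eq _
        _ ≤ ({a, b} : Set α).encard := M.eRk_le_encard _
        _ = 2 := by rw [Set.encard_pair hab]
    · rw [← ThmN.eRk_eq_two_of_mem_trianglesThrough M (⟨hL.1, hL.2, haL⟩ : L ∈ ThmN.trianglesThrough M a)]
      exact M.eRk_mono Set.subset_union_right
  have hcard := hC1 _ hWE hrW
  have hne : T ≠ T ∪ L := by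
    intro h
    apply hTL
    have hLT : L ⊆ T := by rw [h]; exact Set.subset_union_right
    exact (Set.eq_of_subset_of_ncard_le hLT (by rw [hT.2, hL.2]) hTfin).symm
  have hlt := Set.ncard_lt_ncard (Set.subset_union_left.ssubset_of_ne hne) (hTfin.union hLfin)
  rw [hT.2] at hlt
  omega


end S1

end PercRepro
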